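import Literature.NumberTheory.EllipticCurves.Kramer1981.KernelReductionTwoDivisible
import Literature.NumberTheory.EllipticCurves.UnramifiedFormalGroupH1Proofs
import HarnessLib

/-!
# The kernel of reduction is cohomologically trivial for an unramified quadratic automorphism
# (Kramer–Tunnell 1982, Lemma 6.1: the `E₁`-layer of "Lang's theorem")

`Proofs` file (theorems only; no definitions, no named facts) in topic
`NumberTheory/EllipticCurves`, second bottom-up step of the discharge of the named fact
`Literature.NumberTheory.EllipticCurves.KramerTunnell1982.lemma61_unramifiedNormIndex`
(`KramerTunnell1982/UnramifiedNormIndex.lean`; K. Kramer, J. Tunnell, *Elliptic curves and local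
ε-factors*, Compositio Math. 46 (1982), §6 Lemma 6.1, p. 327).  The printed proof uses

> "It follows from Lang's theorem [9] that `N : E₀(K) → E₀(F)` is surjective"

for an unramified quadratic extension `K/F` of local fields with `Gal(K/F) = ⟨g⟩`, `N = 1 + g`,
together with (implicitly, in "`dim E(F)/NE(K) = dim H⁰(G, X)`") `H¹(G, E₀(K)) = 0`.  On the
kernel of reduction `E₁(K)` both statements are the classical successive approximation along the
filtration `E₁ ⊃ E₂ ⊃ ⋯` with graded pieces `k_K⁺` (Serre, *Local Fields*, V §2 for the
multiplicative group; Mazur, Invent. Math. 18 (1972), §4), the graded equations being solvable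
because the trace `k_K → k_F` is onto and `H¹(Gal(k_K/k_F), k_K⁺) = 0`.

This file proves the `E₁`-layer over an abstract non-archimedean local field `K` (Mathlib
`IsNonarchimedeanLocalField`), for a `w`-integral elliptic equation `V = X ⊗ K` (`X` over a
subfield `E`), an isometric `E`-automorphism `σ` of `K` with `σ² = 1` acting on `V(K)` by
transport of coordinates, a `σ`-fixed element `π` with `0 < |π| < 1` such that `|y| < 1 ⇒ |y| ≤ |π|`
(an `E`-rational uniformiser: `K/K^σ` unramified), and an element `θ ∈ 𝒪_K` with `θ + σθ` a
unit (which replaces the residue-field trace argument: for `σ`-fixed `α`, `β = αθ/(θ + σθ)` solves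
`β + σβ = α` exactly, and for `σα ≡ -α`, `β = -αθ/(θ + σθ)` solves `σβ - β ≡ α`):

* `exists_add_map_eq_of_mem_kernel` — **`Ĥ⁰ = 0` on `E₁`**: every `σ`-fixed `a ∈ E₁(K)` is
  `b + σb` with `b ∈ E₁(K)`;
* `exists_map_sub_eq_of_mem_kernel` — **`H¹ = 0` on `E₁`**: every `a ∈ E₁(K)` with `a + σa = O`
  is `σb - b` with `b ∈ E₁(K)`.

Both are instances of one successive-approximation scheme `exists_eq_of_levelwise` for an additive
operator `L` on `V(K)` that preserves `E₁`, does not increase `|z|`, and whose graded equations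
are solvable (`hstep`); the analytic inputs — completeness of `K`
(`Kramer1981.exists_limit_of_geometric`) and Hensel lifts of parameters
(`exists_mem_kernel_zCoord_eq`, here for any integral elliptic equation over `K`, generalising
`Kramer1981.exists_mem_kernel_zCoord_eq`) — come from the tree's local-field plumbing
(`Kramer1981/KernelReductionTwoDivisible.lean`), the chart calculus from `FormalGroupChart`.

## References

* [KramerTunnell1982] K. Kramer, J. Tunnell, Compositio Math. 46 (1982) 307–352, §6, proof of
  Lemma 6.1 (p. 327) and §7 (the filtration `E_n(F)`, p. 328).
* [Mazur1972] B. Mazur, *Rational points of abelian varieties with values in towers of number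
  fields*, Invent. Math. 18 (1972), §4 (norms in unramified extensions).
* [SerreLocalFields1979] J.-P. Serre, *Local Fields*, GTM 67, V §2 (filtrations and norms),
  XIII §1.
* [SilvermanAEC2009] J. H. Silverman, *The Arithmetic of Elliptic Curves*, 2nd ed., IV.1, IV.3,
  VII.2.2 (`E₁(K) ≅ Ê(𝓜)`, the filtration `E_n`).

## Design

No definitions; `noncomputable section`; `open scoped Classical NNReal`.  The real valuation `w`
of `K` is threaded as a hypothesis `hw : w a = ‖a‖` (as in `Kramer1981/KernelReductionTwoDivisible`).
The automorphism acts by Mathlib's `WeierstrassCurve.Affine.Point.map (σ : K →ₐ[E] K)`; one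
universe `u` for `E`, `K` (the tree's `zCoord_map` / `map_mem_kernel_iff` are universe-monomorphic).
-/

noncomputable section

open scoped Classical NNReal
open ValuativeRel Field Polynomial
open Literature.NumberTheory.GaloisRepresentations
open Literature.NumberTheory.GaloisRepresentations.IsNonarchimedeanLocalField
open Literature.NumberTheory.EllipticCurves.FormalGroupChart
open _root_.WeierstrassCurve

universe u

namespace Literature.NumberTheory.EllipticCurves.KramerTunnell1982

variable {K : Type u} [Field K] [ValuativeRel K] [TopologicalSpace K] [IsNonarchimedeanLocalField K]

/-! ## §0 Private local-field plumbing (as in `Kramer1981/KernelReductionTwoDivisible`) -/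

/-- Hensel's lemma in `𝒪[K]`. [folklore] -/
private theorem henselianLocalRing_integer' : HenselianLocalRing 𝒪[K] := by
  letI := IsTopologicalAddGroup.rightUniformSpace K
  haveI := isUniformAddGroup_of_addCommGroup (G := K)
  exact
    { is_henselian := fun f hf a₀ h₁ h₂ =>
        HenselianRing.is_henselian (I := 𝓂[K]) f hf a₀ h₁ (h₂.map _) }

omit [TopologicalSpace K] [IsNonarchimedeanLocalField K] in
/-- Units of `𝒪[K]` are the elements of valuation `1`. [folklore] -/
private theorem isUnit_integer_iff' {a : 𝒪[K]} : IsUnit a ↔ valuation K (a : K) = 1 :=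
  (Valuation.integer.integers (valuation K)).isUnit_iff_valuation_eq_one

/-- `𝓂[K]` is the set of elements of valuation `< 1`. [folklore] -/
private theorem mem_maximalIdeal_iff' {a : 𝒪[K]} : a ∈ 𝓂[K] ↔ valuation K (a : K) < 1 := by
  rw [IsLocalRing.mem_maximalIdeal, mem_nonunits_iff,
    Valuation.Integer.not_isUnit_iff_valuation_lt_one]

/-- `x ≡ 1 (mod 𝓂)` implies `x` is a unit. [folklore] -/
private theorem isUnit_of_sub_one_mem {x : 𝒪[K]} (hx : x - 1 ∈ 𝓂[K]) : IsUnit x := by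
  by_contra hxu
  have hxm : x ∈ 𝓂[K] := (IsLocalRing.mem_maximalIdeal _).mpr hxu
  have h1 : (1 : 𝒪[K]) ∈ 𝓂[K] := by
    have e : (1 : 𝒪[K]) = x - (x - 1) := by ring
    rw [e]; exact Ideal.sub_mem _ hxm hx
  exact (IsLocalRing.maximalIdeal.isMaximal 𝒪[K]).ne_top ((Ideal.eq_top_iff_one _).mpr h1)

section RealValuation

variable {w : Valuation K ℝ≥0}
  (hw : ∀ a : K, (w a : ℝ) = algNorm K (algebraMap K (AlgebraicClosure K) a))
include hw

/-- `w a ≤ 1 ↔ a ∈ 𝒪[K]`. [folklore] -/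
private theorem w_le_one_iff (a : K) : w a ≤ 1 ↔ a ∈ 𝒪[K] := by
  rw [← NNReal.coe_le_coe, hw, NNReal.coe_one]
  exact algNorm_algebraMap_le_one_iff

/-- `w a < 1 ↔ v(a) < 1`. [folklore] -/
private theorem w_lt_one_iff (a : K) : w a < 1 ↔ valuation K a < 1 := by
  rw [← NNReal.coe_lt_coe, hw, NNReal.coe_one]
  exact algNorm_algebraMap_lt_one_iff

/-- For `a ∈ 𝒪[K]`: `w a < 1 ↔ a ∈ 𝓂[K]`. [folklore] -/
private theorem w_coe_lt_one_iff (a : 𝒪[K]) : w (a : K) < 1 ↔ a ∈ 𝓂[K] := by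
  rw [w_lt_one_iff hw, mem_maximalIdeal_iff']

/-- For `a ∈ 𝒪[K]`: `w a = 1 ↔ a` is a unit. [folklore] -/
private theorem w_coe_eq_one_iff (a : 𝒪[K]) : w (a : K) = 1 ↔ IsUnit a := by
  rw [isUnit_integer_iff']
  have h1 : w (a : K) ≤ 1 := (w_le_one_iff hw _).mpr a.2
  have h2 : valuation K (a : K) ≤ 1 := a.2
  have h3 : w (a : K) < 1 ↔ valuation K (a : K) < 1 := w_lt_one_iff hw (a : K)
  constructor
  · intro h
    by_contra hne
    have := h3.mpr (lt_of_le_of_ne h2 hne)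
    rw [h] at this
    exact lt_irrefl _ this
  · intro h
    by_contra hne
    have := h3.mp (lt_of_le_of_ne h1 hne)
    rw [h] at this
    exact lt_irrefl _ this

/-! ## §1 Hensel: every small parameter is `z(P)` for a point of `E₁(K)` -/

/-- **`z : E₁(K) → 𝔪_K` is onto** for any `w`-integral elliptic equation `V` over the local field
`K` (Silverman, *AEC*, Prop. VII.2.2: `E₁(K) ≅ Ê(𝓜)` for complete `K`): for `w a < 1` there is
`P ∈ E₁(K)` with `z(P) = a` — Hensel's lemma in `𝒪[K]` on the monic cubic of
`FormalGroupChart.approxRoot` (`v³ + u v² + t a³ v - a₆ a⁶`, simple root near `-u`).  This is the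
tree's `Kramer1981.exists_mem_kernel_zCoord_eq` (stated there for `W ⊗ K`, `W` over `𝒪[K]`)
for an arbitrary integral equation. [cite: SilvermanAEC2009, Prop. VII.2.2] -/
theorem exists_mem_kernel_zCoord_eq (V : WeierstrassCurve K) [hE : V.IsElliptic]
    [hV : V.IsIntegral w.integer] {a : K} (ha : w a < 1) :
    ∃ P ∈ kernel w V, P.zCoord = a := by
  haveI : HenselianLocalRing 𝒪[K] := henselianLocalRing_integer'
  by_cases ha0 : a = 0
  · exact ⟨0, (kernel w V).zero_mem, by rw [WeierstrassCurve.Affine.Point.zCoord_zero, ha0]⟩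
  have ha0' : 0 < w a := (Valuation.pos_iff _).mpr ha0
  have ha1 : w a ≤ 1 := ha.le
  -- the coefficients and `a` as elements of `𝒪[K]`
  have hmem : ∀ {b : K}, w b ≤ 1 → b ∈ 𝒪[K] := fun hb => (w_le_one_iff hw _).mp hb
  set a₀ : 𝒪[K] := ⟨a, hmem ha1⟩ with ha₀def
  set A₁ : 𝒪[K] := ⟨V.a₁, hmem val_a₁_le_one⟩ with hA₁
  set A₂ : 𝒪[K] := ⟨V.a₂, hmem val_a₂_le_one⟩ with hA₂
  set A₃ : 𝒪[K] := ⟨V.a₃, hmem val_a₃_le_one⟩ with hA₃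
  set A₄ : 𝒪[K] := ⟨V.a₄, hmem val_a₄_le_one⟩ with hA₄
  set A₆ : 𝒪[K] := ⟨V.a₆, hmem val_a₆_le_one⟩ with hA₆
  have ha₀ : (a₀ : K) = a := rfl
  have ha₀m : a₀ ∈ 𝓂[K] := (w_coe_lt_one_iff hw a₀).mp ha
  set u₀ : 𝒪[K] := 1 - A₁ * a₀ - A₂ * a₀ ^ 2 with hu₀
  set c₀ : 𝒪[K] := (A₃ + A₄ * a₀) * a₀ ^ 3 with hc₀
  set d₀ : 𝒪[K] := A₆ * a₀ ^ 6 with hd₀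
  have hc₀m : c₀ ∈ 𝓂[K] := by
    rw [hc₀, pow_succ, ← mul_assoc]
    exact Ideal.mul_mem_left _ _ ha₀m
  have hd₀m : d₀ ∈ 𝓂[K] := by
    rw [hd₀, pow_succ, ← mul_assoc]
    exact Ideal.mul_mem_left _ _ ha₀m
  have hu₀1 : u₀ - 1 ∈ 𝓂[K] := by
    have e : u₀ - 1 = -(A₁ + A₂ * a₀) * a₀ := by rw [hu₀]; ring
    rw [e]
    exact Ideal.mul_mem_left _ _ ha₀m
  have hu₀unit : IsUnit u₀ := isUnit_of_sub_one_mem (K := K) hu₀1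
  set f : (𝒪[K])[X] := X ^ 3 + C u₀ * X ^ 2 + C c₀ * X - C d₀ with hf
  have hfmonic : f.Monic := by
    rw [hf, sub_eq_add_neg, add_assoc, add_assoc]
    refine (monic_X_pow 3).add_of_left ?_
    refine (degree_add_le _ _).trans_lt (max_lt ?_ ((degree_add_le _ _).trans_lt (max_lt ?_ ?_)))
    · exact (degree_C_mul_X_pow_le 2 _).trans_lt (by rw [degree_X_pow]; norm_num)
    · exact (degree_C_mul_X_le _).trans_lt (by rw [degree_X_pow]; norm_num)
    · rw [degree_neg]; exact (degree_C_le).trans_lt (by rw [degree_X_pow]; norm_num)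
  have hfeval : ∀ Y : 𝒪[K], f.eval Y = Y ^ 3 + u₀ * Y ^ 2 + c₀ * Y - d₀ := by
    intro Y
    rw [hf]
    simp only [eval_add, eval_sub, eval_mul, eval_pow, eval_X, eval_C]
  have hfder : ∀ Y : 𝒪[K], f.derivative.eval Y = 3 * Y ^ 2 + u₀ * (2 * Y) + c₀ := by
    intro Y
    rw [hf]
    simp only [derivative_add, derivative_sub, derivative_mul, derivative_X_pow, derivative_C,
      derivative_X, zero_mul, zero_add, mul_one, sub_zero, eval_add, eval_mul, eval_pow, eval_X,
      eval_C]
    push_cast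
    ring
  have h₁ : f.eval (-u₀) ∈ 𝓂[K] := by
    rw [hfeval]
    have e : (-u₀) ^ 3 + u₀ * (-u₀) ^ 2 + c₀ * (-u₀) - d₀ = -(c₀ * u₀ + d₀) := by ring
    rw [e]
    exact neg_mem (Ideal.add_mem _ (Ideal.mul_mem_right _ _ hc₀m) hd₀m)
  have h₂ : IsUnit (f.derivative.eval (-u₀)) := by
    rw [hfder]
    refine isUnit_of_sub_one_mem (K := K) ?_
    have e : 3 * (-u₀) ^ 2 + u₀ * (2 * -u₀) + c₀ - 1 = (u₀ - 1) * (u₀ + 1) + c₀ := by ring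
    rw [e]
    exact Ideal.add_mem _ (Ideal.mul_mem_right _ _ hu₀1) hc₀m
  obtain ⟨r, hr, hru⟩ := HenselianLocalRing.is_henselian f hfmonic (-u₀) h₁ h₂
  have hrunit : IsUnit r := by
    rw [← IsUnit.neg_iff]
    refine isUnit_of_sub_one_mem (K := K) ?_
    have e : -r - 1 = -(r - -u₀) + (u₀ - 1) := by ring
    rw [e]
    exact Ideal.add_mem _ (neg_mem hru) hu₀1
  have hrv : w (r : K) = 1 := (w_coe_eq_one_iff hw r).mpr hrunit
  have ha3 : a ^ 3 ≠ 0 := pow_ne_zero 3 ha0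
  set y : K := (r : K) / a ^ 3 with hy
  have hya : y * a ^ 3 = (r : K) := by rw [hy, div_mul_cancel₀ _ ha3]
  have hwy : w y * w a ^ 3 = 1 := by rw [← map_pow, ← map_mul, hya, hrv]
  have hy0 : y ≠ 0 := by
    intro h; rw [h, map_zero, zero_mul] at hwy; exact zero_ne_one hwy
  have hroot : (r : K) ^ 3 + ((u₀ : 𝒪[K]) : K) * (r : K) ^ 2 + ((c₀ : 𝒪[K]) : K) * r -
      ((d₀ : 𝒪[K]) : K) = 0 := by
    have h : f.eval r = 0 := hr
    rw [hfeval] at h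
    have h' := congrArg ((↑) : 𝒪[K] → K) h
    push_cast at h'
    exact h'
  have hu : ((u₀ : 𝒪[K]) : K) = 1 - V.a₁ * a - V.a₂ * a ^ 2 := by
    rw [hu₀]; push_cast; rw [ha₀]
  have hc : ((c₀ : 𝒪[K]) : K) = (V.a₃ + V.a₄ * a) * a ^ 3 := by
    rw [hc₀]; push_cast; rw [ha₀]
  have hd : ((d₀ : 𝒪[K]) : K) = V.a₆ * a ^ 6 := by
    rw [hd₀]; push_cast; rw [ha₀]
  rw [← hya, hu, hc, hd] at hroot
  have hg6 : a ^ 6 * (a ^ 3 * y ^ 3 + (1 - V.a₁ * a - V.a₂ * a ^ 2) * y ^ 2 +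
      (V.a₃ + V.a₄ * a) * y - V.a₆) = 0 := by
    rw [← monic_cubic_eval]
    linear_combination hroot
  have hg := (mul_eq_zero.mp hg6).resolve_left (pow_ne_zero 6 ha0)
  have heq : V.toAffine.Equation (-a * y) y := equation_of_root hg
  have hns : V.toAffine.Nonsingular (-a * y) y :=
    WeierstrassCurve.Affine.equation_iff_nonsingular.mp heq
  refine ⟨.some (-a * y) y hns, some_mem_kernel hns (one_lt_val_of_root ha0' ha hwy), ?_⟩
  rw [WeierstrassCurve.Affine.Point.zCoord_some, neg_mul, neg_neg, mul_div_cancel_right₀ _ hy0]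

/-! ## §2 Successive approximation for an operator on `E₁(K)` -/

/-- **Successive approximation in `E₁(K)`** (the scheme of Serre, *Local Fields*, V §2, for an
additive operator).  Let `V` be a `w`-integral elliptic equation over the local field `K`,
`0 < ρ < 1`, `L` an additive operator on `V(K)` preserving `E₁` and not increasing `|z|`, and `T`
a subgroup of `V(K)` containing `L(V(K))`.  If for every `n ≥ 1` and every `a ∈ E₁ ∩ T` with
`|z(a)| ≤ ρⁿ` there is `b ∈ E₁` with `|z(b)| ≤ ρⁿ` and `|z(a - L b)| ≤ ρⁿ⁺¹` (the graded equations
are solvable), then every `a ∈ E₁ ∩ T` with `|z(a)| ≤ ρ` is `L(B)` for some `B ∈ E₁`: the partial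
sums `Σ bᵢ` have Cauchy parameters (`|z(P + Q) - z(P)| = |z(Q)|`), converge in the complete field
`K` (`Kramer1981.exists_limit_of_geometric`) to the parameter of a point `B ∈ E₁`
(`exists_mem_kernel_zCoord_eq`), and `a - L(B)` has parameter of size `≤ ρⁿ` for every `n`.
[cite: SerreLocalFields1979, Ch. V §2 (successive approximation along the filtration)] -/
theorem exists_eq_of_levelwise (V : WeierstrassCurve K) [V.IsElliptic] [V.IsIntegral w.integer]
    (L : V.toAffine.Point →+ V.toAffine.Point) (T : AddSubgroup V.toAffine.Point)
    (hLker : ∀ P ∈ kernel w V, L P ∈ kernel w V ∧ w (L P).zCoord ≤ w P.zCoord)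
    (hLT : ∀ P, L P ∈ T) {ρ : ℝ≥0} (hρ1 : ρ < 1)
    (hstep : ∀ n : ℕ, 1 ≤ n → ∀ a ∈ kernel w V, a ∈ T → w a.zCoord ≤ ρ ^ n →
      ∃ b ∈ kernel w V, w b.zCoord ≤ ρ ^ n ∧ w (a - L b).zCoord ≤ ρ ^ (n + 1))
    {a : V.toAffine.Point} (haK : a ∈ kernel w V) (haT : a ∈ T) (ha1 : w a.zCoord ≤ ρ) :
    ∃ B ∈ kernel w V, L B = a := by
  -- invariant at level `r` (bound `ρ^{r+1}`): `s = (a', B')`, `a', B' ∈ E₁`, `a' ∈ T`,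
  -- `|z(a')| ≤ ρ^{r+1}`, `a = a' + L B'`
  let Inv : ℕ → V.toAffine.Point × V.toAffine.Point → Prop := fun r s =>
    s.1 ∈ kernel w V ∧ s.1 ∈ T ∧ s.2 ∈ kernel w V ∧ w s.1.zCoord ≤ ρ ^ (r + 1) ∧ a = s.1 + L s.2
  have hInv0 : Inv 0 (a, 0) := by
    refine ⟨haK, haT, (kernel w V).zero_mem, by rwa [zero_add, pow_one], ?_⟩
    change a = a + L 0
    rw [map_zero, add_zero]
  have hnext : ∀ (r : ℕ) (s : {s // Inv r s}), ∃ s' : {s' // Inv (r + 1) s'},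
      w (s'.1.2.zCoord - s.1.2.zCoord) ≤ ρ ^ (r + 1) := by
    rintro r ⟨⟨a', B'⟩, ha'K, ha'T, hB'K, ha'z, haB'⟩
    dsimp only at ha'K ha'T hB'K ha'z haB'
    obtain ⟨b, hbK, hbz, hab⟩ := hstep (r + 1) (Nat.le_add_left 1 r) a' ha'K ha'T ha'z
    have hLbK : L b ∈ kernel w V := (hLker b hbK).1
    refine ⟨⟨(a' - L b, B' + b), (kernel w V).sub_mem ha'K hLbK, T.sub_mem ha'T (hLT b),
      (kernel w V).add_mem hB'K hbK, hab, ?_⟩, ?_⟩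
    · change a = (a' - L b) + L (B' + b)
      rw [haB', map_add]; abel
    · change w ((B' + b).zCoord - B'.zCoord) ≤ ρ ^ (r + 1)
      rw [val_zCoord_add_sub_eq hB'K hbK]
      exact hbz
  choose next hnext using hnext
  let seq : ∀ r : ℕ, {s // Inv r s} := fun r => Nat.rec ⟨(a, 0), hInv0⟩ (fun r s => next r s) r
  have hseq_succ : ∀ r, seq (r + 1) = next r (seq r) := fun r => rfl
  -- the parameters of the partial sums form a Cauchy sequence
  let x : ℕ → K := fun r => (seq r).1.2.zCoord
  have hcauchy : ∀ r, w (x (r + 1) - x r) ≤ ρ * ρ ^ r := by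
    intro r
    change w ((seq (r + 1)).1.2.zCoord - (seq r).1.2.zCoord) ≤ _
    rw [hseq_succ, ← pow_succ']
    exact hnext r (seq r)
  obtain ⟨y, hy⟩ := Kramer1981.exists_limit_of_geometric hw x ρ ρ hρ1 hcauchy
  have hx0 : x 0 = 0 := WeierstrassCurve.Affine.Point.zCoord_zero
  have hyw : w y < 1 := by
    have h := hy 0
    rw [hx0, sub_zero, pow_zero, mul_one] at h
    exact h.trans_lt hρ1
  obtain ⟨B, hBK, hBz⟩ := exists_mem_kernel_zCoord_eq hw V hyw
  refine ⟨B, hBK, ?_⟩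
  -- `a - L B` has arbitrarily small parameter
  have hDK0 : a - L B ∈ kernel w V := (kernel w V).sub_mem haK (hLker B hBK).1
  have hsmall : ∀ r, w (a - L B).zCoord ≤ ρ ^ (r + 1) := by
    intro r
    obtain ⟨ha'K, -, hB'K, ha'z, haB'⟩ := (seq r).2
    have hDK : B - (seq r).1.2 ∈ kernel w V := (kernel w V).sub_mem hBK hB'K
    have hDz : w (B - (seq r).1.2).zCoord ≤ ρ ^ (r + 1) := by
      rw [← val_zCoord_sub hBK hB'K, hBz, pow_succ']
      exact hy r
    have hLD : w (L (B - (seq r).1.2)).zCoord ≤ ρ ^ (r + 1) := (hLker _ hDK).2.trans hDz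
    have e : a - L B = (seq r).1.1 - L (B - (seq r).1.2) := by
      conv_lhs => rw [haB']
      rw [map_sub]; abel
    rw [e]
    exact (val_zCoord_sub_le ha'K (hLker _ hDK).1).trans (max_le ha'z hLD)
  have hz0 : (a - L B).zCoord = 0 := by
    by_contra h0
    have hpos : 0 < w (a - L B).zCoord := (Valuation.pos_iff w).mpr h0
    obtain ⟨r, hr⟩ := exists_pow_lt_of_lt_one hpos hρ1
    have h1 : ρ ^ (r + 1) ≤ ρ ^ r := pow_le_pow_right_of_le_one' hρ1.le (Nat.le_succ r)
    exact lt_irrefl _ (((hsmall r).trans h1).trans_lt hr)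
  have h := (zCoord_eq_zero_iff hDK0).mp hz0
  rw [sub_eq_zero] at h
  exact h.symm

end RealValuation

/-! ## §3 An isometric involution: the graded equations for `1 + σ` and `σ - 1` -/

section Sigma

variable {E : Type u} [Field E] [Algebra E K] (X : WeierstrassCurve E)
  {w : Valuation K ℝ≥0}
  (hw : ∀ a : K, (w a : ℝ) = algNorm K (algebraMap K (AlgebraicClosure K) a))
  [hE : (X.baseChange K).IsElliptic] [hV : (X.baseChange K).IsIntegral w.integer]
  {σ : K ≃ₐ[E] K} (hσw : ∀ y, w (σ y) = w y) (hσσ : ∀ y, σ (σ y) = y)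
  {π : K} (hπσ : σ π = π) (hπ0 : 0 < w π) (hπ1 : w π < 1)
  {θ : K} (hθ : w θ ≤ 1) (hθt : w (θ + σ θ) = 1)

omit [ValuativeRel K] [TopologicalSpace K] [IsNonarchimedeanLocalField K] in
/-- `(σ : K →ₐ[E] K) z = σ z` (the coercion `AlgEquiv → AlgHom` on elements). [folklore] -/
private theorem algHom_coe_apply (τ : K ≃ₐ[E] K) (z : K) : (τ : K →ₐ[E] K) z = τ z := rfl

include hσw in
omit [ValuativeRel K] [TopologicalSpace K] [IsNonarchimedeanLocalField K] hE in
/-- `σ` preserves `E₁` and `|z|`. [folklore] -/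
private theorem map_mem_kernel_and (P : (X.baseChange K).toAffine.Point)
    (hP : P ∈ kernel w (X.baseChange K)) :
    WeierstrassCurve.Affine.Point.map (σ : K →ₐ[E] K) P ∈ kernel w (X.baseChange K) ∧
      w (WeierstrassCurve.Affine.Point.map (σ : K →ₐ[E] K) P).zCoord = w P.zCoord := by
  refine ⟨(map_mem_kernel_iff (X := X) (F := (σ : K →ₐ[E] K)) hσw P).mpr hP, ?_⟩
  rw [zCoord_map]
  exact hσw _

include hσσ in
omit [ValuativeRel K] [TopologicalSpace K] [IsNonarchimedeanLocalField K] hE hV in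
/-- `σ² = 1` on points. [folklore] -/
private theorem map_map_self (P : (X.baseChange K).toAffine.Point) :
    WeierstrassCurve.Affine.Point.map (σ : K →ₐ[E] K)
      (WeierstrassCurve.Affine.Point.map (σ : K →ₐ[E] K) P) = P := by
  rw [WeierstrassCurve.Affine.Point.map_map]
  have h : (σ : K →ₐ[E] K).comp (σ : K →ₐ[E] K) = AlgHom.id E K := by
    ext y
    exact hσσ y
  rw [h]
  cases P <;> rfl

include hw hσw hσσ hπσ hπ0 hπ1 hθ hθt in
/-- **The graded norm equation.**  For `n ≥ 1` and a `σ`-fixed `a ∈ E₁(K)` with `|z(a)| ≤ |π|ⁿ`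
there is `b ∈ E₁(K)` with `|z(b)| ≤ |π|ⁿ` and `|z(a - (b + σb))| ≤ |π|ⁿ⁺¹`: with
`α = z(a)/πⁿ ∈ 𝒪_K` (`σ`-fixed) and `t = θ + σθ ∈ 𝒪_K^×`, the element `β = αθ/t` satisfies
`β + σβ = α` exactly; `b` is the point with `z(b) = πⁿβ` (Hensel), and
`z(b + σb) ≡ z(b) + σ z(b) = z(a)` modulo `|π|²ⁿ`.  (The graded piece `E_n/E_{n+1} ≅ k_K⁺` and
the surjectivity of the trace `k_K → k_F`, Kramer–Tunnell §7 / Serre V §2.)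
[cite: KramerTunnell1982, §6 proof of Lemma 6.1 (p. 327), "N : E₀(K) → E₀(F) is surjective"] -/
theorem exists_norm_step (n : ℕ) (hn : 1 ≤ n) {a : (X.baseChange K).toAffine.Point}
    (haK : a ∈ kernel w (X.baseChange K))
    (haσ : WeierstrassCurve.Affine.Point.map (σ : K →ₐ[E] K) a = a)
    (haz : w a.zCoord ≤ w π ^ n) :
    ∃ b ∈ kernel w (X.baseChange K), w b.zCoord ≤ w π ^ n ∧
      w (a - (b + WeierstrassCurve.Affine.Point.map (σ : K →ₐ[E] K) b)).zCoord ≤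
        w π ^ (n + 1) := by
  have hπ0' : π ≠ 0 := (Valuation.pos_iff _).mp hπ0
  have hπn0 : π ^ n ≠ 0 := pow_ne_zero n hπ0'
  obtain ⟨t, ht⟩ : ∃ t : K, t = θ + σ θ := ⟨_, rfl⟩
  have htw : w t = 1 := by rw [ht]; exact hθt
  have ht0 : t ≠ 0 := fun h => by rw [h, map_zero] at htw; exact zero_ne_one htw
  have hσt : σ t = t := by rw [ht, map_add, hσσ, add_comm]
  -- `α = z(a)/πⁿ`, `β = α θ / t`
  obtain ⟨α, hα⟩ : ∃ α : K, α = a.zCoord / π ^ n := ⟨_, rfl⟩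
  have hσz : σ a.zCoord = a.zCoord := by
    have h := zCoord_map (X := X) (σ : K →ₐ[E] K) a
    rw [haσ, algHom_coe_apply] at h
    exact h.symm
  have hσα : σ α = α := by rw [hα, map_div₀, hσz, map_pow, hπσ]
  have hαw : w α ≤ 1 := by
    rw [hα, map_div₀, map_pow, div_le_one (pow_pos hπ0 n)]
    exact haz
  obtain ⟨β, hβ⟩ : ∃ β : K, β = α * θ / t := ⟨_, rfl⟩
  have hβσ : β + σ β = α := by
    rw [hβ, map_div₀, map_mul, hσα, hσt, ← add_div, ← mul_add, ← ht, mul_div_cancel_right₀ _ ht0]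
  have hβw : w β ≤ 1 := by
    rw [hβ, map_div₀, map_mul, htw, div_one]
    exact mul_le_one' hαw hθ
  -- the point `b` with `z(b) = πⁿ β`
  have hzb : w (π ^ n * β) ≤ w π ^ n := by
    rw [map_mul, map_pow]
    exact mul_le_of_le_one_right zero_le hβw
  have hzb1 : w (π ^ n * β) < 1 :=
    hzb.trans_lt (pow_lt_one₀ zero_le hπ1 (by omega))
  obtain ⟨b, hbK, hbz⟩ := exists_mem_kernel_zCoord_eq hw (X.baseChange K) hzb1
  have hbz' : w b.zCoord ≤ w π ^ n := by rw [hbz]; exact hzb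
  obtain ⟨hσbK, hσbz⟩ := map_mem_kernel_and X hσw b hbK
  refine ⟨b, hbK, hbz', ?_⟩
  -- `z(b + σ b) ≡ z b + z(σ b) = πⁿ(β + σβ) = z(a)` modulo `|π|^{2n}`
  have hsum : b.zCoord + (WeierstrassCurve.Affine.Point.map (σ : K →ₐ[E] K) b).zCoord =
      a.zCoord := by
    rw [zCoord_map, algHom_coe_apply, hbz, map_mul, map_pow, hπσ, ← mul_add, hβσ, hα]
    field_simp
  have hNbK : b + WeierstrassCurve.Affine.Point.map (σ : K →ₐ[E] K) b ∈ kernel w (X.baseChange K) :=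
    (kernel w (X.baseChange K)).add_mem hbK hσbK
  have h1 : w ((b + WeierstrassCurve.Affine.Point.map (σ : K →ₐ[E] K) b).zCoord - a.zCoord) ≤
      w π ^ (n + 1) := by
    rw [← hsum, ← sub_sub]
    refine (val_zCoord_add_sub_le hbK hσbK).trans ?_
    rw [hσbz, max_self]
    calc w b.zCoord ^ 2 ≤ (w π ^ n) ^ 2 := by gcongr
      _ = w π ^ (n + n) := by ring
      _ ≤ w π ^ (n + 1) := pow_le_pow_right_of_le_one' hπ1.le (by omega)
  rw [← val_zCoord_sub haK hNbK, ← Valuation.map_neg, neg_sub]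
  exact h1

include hw hσw hσσ hπσ hπ0 hπ1 hθ hθt in
/-- **The graded coboundary equation.**  For `n ≥ 1` and `a ∈ E₁(K)` with `a + σa = O` and
`|z(a)| ≤ |π|ⁿ` there is `b ∈ E₁(K)` with `|z(b)| ≤ |π|ⁿ` and `|z(a - (σb - b))| ≤ |π|ⁿ⁺¹`: with
`α = z(a)/πⁿ` one has `σα ≡ -α` modulo `|π|ⁿ` (`z(-a) ≡ -z(a)` to second order), and
`β = -αθ/t`, `t = θ + σθ`, satisfies `σβ - β ≡ α`; take `z(b) = πⁿβ`.  (Additive Hilbert 90 for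
the graded piece `k_K⁺`, Serre, *Local Fields*, X §1.)
[cite: KramerTunnell1982, §6 proof of Lemma 6.1 (p. 327), "dim E(F)/NE(K) = dim H⁰(G, X)"] -/
theorem exists_coboundary_step (n : ℕ) (hn : 1 ≤ n) {a : (X.baseChange K).toAffine.Point}
    (haK : a ∈ kernel w (X.baseChange K))
    (haσ : a + WeierstrassCurve.Affine.Point.map (σ : K →ₐ[E] K) a = 0)
    (haz : w a.zCoord ≤ w π ^ n) :
    ∃ b ∈ kernel w (X.baseChange K), w b.zCoord ≤ w π ^ n ∧
      w (a - (WeierstrassCurve.Affine.Point.map (σ : K →ₐ[E] K) b - b)).zCoord ≤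
        w π ^ (n + 1) := by
  have hπ0' : π ≠ 0 := (Valuation.pos_iff _).mp hπ0
  have hπn0 : π ^ n ≠ 0 := pow_ne_zero n hπ0'
  have hπn : 0 < w π ^ n := pow_pos hπ0 n
  obtain ⟨t, ht⟩ : ∃ t : K, t = θ + σ θ := ⟨_, rfl⟩
  have htw : w t = 1 := by rw [ht]; exact hθt
  have ht0 : t ≠ 0 := fun h => by rw [h, map_zero] at htw; exact zero_ne_one htw
  have hσt : σ t = t := by rw [ht, map_add, hσσ, add_comm]
  obtain ⟨hσaK, hσaz⟩ := map_mem_kernel_and X hσw a haK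
  -- `σ z(a) + z(a)` is small: `σ a = -a` and `|z(a) + z(-a)| ≤ |z a|²`
  have hσa : WeierstrassCurve.Affine.Point.map (σ : K →ₐ[E] K) a = -a :=
    eq_neg_of_add_eq_zero_right haσ
  have hsmall : w (σ a.zCoord + a.zCoord) ≤ (w π ^ n) ^ 2 := by
    have h := val_zCoord_add_sub_le haK hσaK
    rw [haσ, WeierstrassCurve.Affine.Point.zCoord_zero, zero_sub, ← neg_add', Valuation.map_neg,
      hσaz, max_self, zCoord_map, algHom_coe_apply] at h
    rw [add_comm]
    calc w (a.zCoord + σ a.zCoord) ≤ w a.zCoord ^ 2 := h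
      _ ≤ (w π ^ n) ^ 2 := by gcongr
  -- `α = z(a)/πⁿ`, `β = -α θ / t`
  obtain ⟨α, hα⟩ : ∃ α : K, α = a.zCoord / π ^ n := ⟨_, rfl⟩
  have hαw : w α ≤ 1 := by
    rw [hα, map_div₀, map_pow, div_le_one hπn]
    exact haz
  have hσα : w (σ α + α) ≤ w π ^ n := by
    rw [hα, map_div₀, map_pow, hπσ, ← add_div, map_div₀, map_pow, div_le_iff₀ hπn, ← sq]
    exact hsmall
  obtain ⟨β, hβ⟩ : ∃ β : K, β = -(α * θ) / t := ⟨_, rfl⟩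
  have hβw : w β ≤ 1 := by
    rw [hβ, map_div₀, Valuation.map_neg, map_mul, htw, div_one]
    exact mul_le_one' hαw hθ
  have hβσ : w (σ β - β - α) ≤ w π ^ n := by
    have e : σ β - β - α = -((σ α + α) * (σ θ / t)) := by
      rw [hβ, map_div₀, map_neg, map_mul, hσt]
      field_simp
      rw [ht]; ring
    rw [e, Valuation.map_neg, map_mul, map_div₀, hσw, htw, div_one]
    calc w (σ α + α) * w θ ≤ w π ^ n * 1 := mul_le_mul' hσα hθ
      _ = w π ^ n := mul_one _
  -- the point `b` with `z(b) = πⁿ β`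
  have hzb : w (π ^ n * β) ≤ w π ^ n := by
    rw [map_mul, map_pow]
    exact mul_le_of_le_one_right zero_le hβw
  have hzb1 : w (π ^ n * β) < 1 :=
    hzb.trans_lt (pow_lt_one₀ zero_le hπ1 (by omega))
  obtain ⟨b, hbK, hbz⟩ := exists_mem_kernel_zCoord_eq hw (X.baseChange K) hzb1
  have hbz' : w b.zCoord ≤ w π ^ n := by rw [hbz]; exact hzb
  obtain ⟨hσbK, hσbz⟩ := map_mem_kernel_and X hσw b hbK
  have hnbK : -b ∈ kernel w (X.baseChange K) := (kernel w (X.baseChange K)).neg_mem hbK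
  refine ⟨b, hbK, hbz', ?_⟩
  -- `z(σ b - b) ≡ z(σ b) + z(-b) ≡ σ z(b) - z(b) = πⁿ(σβ - β) ≡ πⁿ α = z(a)` modulo `|π|^{n+1}`
  have h2n : (w π ^ n) ^ 2 ≤ w π ^ (n + 1) := by
    calc (w π ^ n) ^ 2 = w π ^ (n + n) := by ring
      _ ≤ w π ^ (n + 1) := pow_le_pow_right_of_le_one' hπ1.le (by omega)
  have hDK : WeierstrassCurve.Affine.Point.map (σ : K →ₐ[E] K) b - b ∈ kernel w (X.baseChange K) :=
    (kernel w (X.baseChange K)).sub_mem hσbK hbK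
  -- (i) `|z(σ b - b) - z(σ b) - z(-b)| ≤ |π|^{2n}`
  have hi : w ((WeierstrassCurve.Affine.Point.map (σ : K →ₐ[E] K) b - b).zCoord -
      (WeierstrassCurve.Affine.Point.map (σ : K →ₐ[E] K) b).zCoord - (-b).zCoord) ≤
      (w π ^ n) ^ 2 := by
    rw [sub_eq_add_neg (WeierstrassCurve.Affine.Point.map (σ : K →ₐ[E] K) b) b]
    refine (val_zCoord_add_sub_le hσbK hnbK).trans ?_
    rw [hσbz, val_zCoord_neg hbK, max_self]
    gcongr
  -- (ii) `|z(-b) + z(b)| ≤ |π|^{2n}`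
  have hii : w ((-b).zCoord + b.zCoord) ≤ (w π ^ n) ^ 2 := by
    have h := val_zCoord_add_sub_le hnbK hbK
    rw [neg_add_cancel, WeierstrassCurve.Affine.Point.zCoord_zero, zero_sub, ← neg_add',
      Valuation.map_neg, val_zCoord_neg hbK, max_self] at h
    calc w ((-b).zCoord + b.zCoord) ≤ w b.zCoord ^ 2 := h
      _ ≤ (w π ^ n) ^ 2 := by gcongr
  -- (iii) `|σ z(b) - z(b) - z(a)| ≤ |π|^{2n}`
  have hiii : w ((WeierstrassCurve.Affine.Point.map (σ : K →ₐ[E] K) b).zCoord - b.zCoord -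
      a.zCoord) ≤ w π ^ (n + 1) := by
    rw [zCoord_map, algHom_coe_apply, hbz, map_mul, map_pow, hπσ]
    have e : π ^ n * σ β - π ^ n * β - a.zCoord = π ^ n * (σ β - β - α) := by
      rw [hα]; field_simp
    rw [e, map_mul, map_pow]
    calc w π ^ n * w (σ β - β - α) ≤ w π ^ n * w π ^ n := mul_le_mul' le_rfl hβσ
      _ = (w π ^ n) ^ 2 := (sq _).symm
      _ ≤ w π ^ (n + 1) := h2n
  -- combine
  have e : a.zCoord - (WeierstrassCurve.Affine.Point.map (σ : K →ₐ[E] K) b - b).zCoord =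
      -(((WeierstrassCurve.Affine.Point.map (σ : K →ₐ[E] K) b - b).zCoord -
          (WeierstrassCurve.Affine.Point.map (σ : K →ₐ[E] K) b).zCoord - (-b).zCoord) +
        ((-b).zCoord + b.zCoord) +
        ((WeierstrassCurve.Affine.Point.map (σ : K →ₐ[E] K) b).zCoord - b.zCoord - a.zCoord)) := by
    ring
  rw [← val_zCoord_sub haK hDK, e, Valuation.map_neg]
  refine (w.map_add_le (w.map_add_le (hi.trans h2n) (hii.trans h2n)) hiii)

include hw hσw hσσ hπσ hπ0 hπ1 hθ hθt in
/-- **`Ĥ⁰(⟨σ⟩, E₁(K)) = 0`: every `σ`-fixed point of the kernel of reduction is a norm.**  For a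
`w`-integral elliptic equation `X ⊗ K` over the local field `K`, an isometric involution `σ` of
`K/E`, a `σ`-fixed `π` with `0 < |π| < 1` and `|y| < 1 ⇒ |y| ≤ |π|` on `K`, and `θ ∈ 𝒪_K` with
`θ + σθ ∈ 𝒪_K^×` (unramifiedness): every `a ∈ E₁(K)` with `σa = a` is `b + σb` for some
`b ∈ E₁(K)`.  This is the `E₁`-layer of "`N : E₀(K) → E₀(F)` is surjective" (Lang's theorem) in
Kramer–Tunnell's proof of Lemma 6.1.
[cite: KramerTunnell1982, §6 proof of Lemma 6.1 (p. 327), "N : E₀(K) → E₀(F) is surjective"] -/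
theorem exists_add_map_eq_of_mem_kernel (hdisc : ∀ y : K, w y < 1 → w y ≤ w π)
    {a : (X.baseChange K).toAffine.Point} (haK : a ∈ kernel w (X.baseChange K))
    (haσ : WeierstrassCurve.Affine.Point.map (σ : K →ₐ[E] K) a = a) :
    ∃ b ∈ kernel w (X.baseChange K), b + WeierstrassCurve.Affine.Point.map (σ : K →ₐ[E] K) b = a := by
  let s : (X.baseChange K).toAffine.Point →+ (X.baseChange K).toAffine.Point :=
    WeierstrassCurve.Affine.Point.map (σ : K →ₐ[E] K)
  let L : (X.baseChange K).toAffine.Point →+ (X.baseChange K).toAffine.Point :=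
    AddMonoidHom.id _ + s
  have hL : ∀ P, L P = P + WeierstrassCurve.Affine.Point.map (σ : K →ₐ[E] K) P := fun P => rfl
  -- the fixed subgroup `T = {P : σ P = P}` contains the norms
  let T : AddSubgroup (X.baseChange K).toAffine.Point := s.eqLocus (AddMonoidHom.id _)
  have hT : ∀ P, P ∈ T ↔ WeierstrassCurve.Affine.Point.map (σ : K →ₐ[E] K) P = P := fun P =>
    Iff.rfl
  have hLT : ∀ P, L P ∈ T := by
    intro P
    rw [hT, hL, map_add, map_map_self X hσσ, add_comm]
  have hLker : ∀ P ∈ kernel w (X.baseChange K),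
      L P ∈ kernel w (X.baseChange K) ∧ w (L P).zCoord ≤ w P.zCoord := by
    intro P hP
    obtain ⟨hσPK, hσPz⟩ := map_mem_kernel_and X hσw P hP
    refine ⟨by rw [hL]; exact (kernel w (X.baseChange K)).add_mem hP hσPK, ?_⟩
    rw [hL]
    refine (val_zCoord_add_le hP hσPK).trans ?_
    rw [hσPz, max_self]
  have hstep : ∀ n : ℕ, 1 ≤ n → ∀ a ∈ kernel w (X.baseChange K), a ∈ T →
      w a.zCoord ≤ w π ^ n → ∃ b ∈ kernel w (X.baseChange K), w b.zCoord ≤ w π ^ n ∧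
        w (a - L b).zCoord ≤ w π ^ (n + 1) := by
    intro n hn a haK haT haz
    obtain ⟨b, hbK, hbz, hab⟩ :=
      exists_norm_step X hw hσw hσσ hπσ hπ0 hπ1 hθ hθt n hn haK ((hT a).mp haT) haz
    exact ⟨b, hbK, hbz, by rw [hL]; exact hab⟩
  have ha1 : w a.zCoord ≤ w π := hdisc _ (val_zCoord_lt_one haK)
  obtain ⟨B, hBK, hB⟩ := exists_eq_of_levelwise hw (X.baseChange K) L T hLker hLT hπ1 hstep haK
    ((hT a).mpr haσ) ha1
  exact ⟨B, hBK, by rw [← hL]; exact hB⟩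

include hw hσw hσσ hπσ hπ0 hπ1 hθ hθt in
/-- **`H¹(⟨σ⟩, E₁(K)) = 0`: every point of the kernel of reduction killed by the norm is a
coboundary.**  In the setting of `exists_add_map_eq_of_mem_kernel`: every `a ∈ E₁(K)` with
`a + σa = O` is `σb - b` for some `b ∈ E₁(K)`.  This is the `E₁`-layer of the vanishing
`H¹(G, E₀(K)) = 0` implicit in Kramer–Tunnell's "`dim E(F)/NE(K) = dim H⁰(G, X)`".
[cite: KramerTunnell1982, §6 proof of Lemma 6.1 (p. 327), "dim E(F)/NE(K) = dim H⁰(G, X)"] -/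
theorem exists_map_sub_eq_of_mem_kernel (hdisc : ∀ y : K, w y < 1 → w y ≤ w π)
    {a : (X.baseChange K).toAffine.Point} (haK : a ∈ kernel w (X.baseChange K))
    (haσ : a + WeierstrassCurve.Affine.Point.map (σ : K →ₐ[E] K) a = 0) :
    ∃ b ∈ kernel w (X.baseChange K), WeierstrassCurve.Affine.Point.map (σ : K →ₐ[E] K) b - b = a := by
  let s : (X.baseChange K).toAffine.Point →+ (X.baseChange K).toAffine.Point :=
    WeierstrassCurve.Affine.Point.map (σ : K →ₐ[E] K)
  let L : (X.baseChange K).toAffine.Point →+ (X.baseChange K).toAffine.Point :=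
    s - AddMonoidHom.id _
  have hL : ∀ P, L P = WeierstrassCurve.Affine.Point.map (σ : K →ₐ[E] K) P - P := fun P => rfl
  -- the subgroup `T = ker(1 + σ)` contains the coboundaries
  let T : AddSubgroup (X.baseChange K).toAffine.Point := (AddMonoidHom.id _ + s).ker
  have hT : ∀ P, P ∈ T ↔ P + WeierstrassCurve.Affine.Point.map (σ : K →ₐ[E] K) P = 0 := fun P =>
    Iff.rfl
  have hLT : ∀ P, L P ∈ T := by
    intro P
    rw [hT, hL, map_sub, map_map_self X hσσ]
    abel
  have hLker : ∀ P ∈ kernel w (X.baseChange K),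
      L P ∈ kernel w (X.baseChange K) ∧ w (L P).zCoord ≤ w P.zCoord := by
    intro P hP
    obtain ⟨hσPK, hσPz⟩ := map_mem_kernel_and X hσw P hP
    refine ⟨by rw [hL]; exact (kernel w (X.baseChange K)).sub_mem hσPK hP, ?_⟩
    rw [hL]
    refine (val_zCoord_sub_le hσPK hP).trans ?_
    rw [hσPz, max_self]
  have hstep : ∀ n : ℕ, 1 ≤ n → ∀ a ∈ kernel w (X.baseChange K), a ∈ T →
      w a.zCoord ≤ w π ^ n → ∃ b ∈ kernel w (X.baseChange K), w b.zCoord ≤ w π ^ n ∧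
        w (a - L b).zCoord ≤ w π ^ (n + 1) := by
    intro n hn a haK haT haz
    obtain ⟨b, hbK, hbz, hab⟩ :=
      exists_coboundary_step X hw hσw hσσ hπσ hπ0 hπ1 hθ hθt n hn haK ((hT a).mp haT) haz
    exact ⟨b, hbK, hbz, by rw [hL]; exact hab⟩
  have ha1 : w a.zCoord ≤ w π := hdisc _ (val_zCoord_lt_one haK)
  obtain ⟨B, hBK, hB⟩ := exists_eq_of_levelwise hw (X.baseChange K) L T hLker hLT hπ1 hstep haK
    ((hT a).mpr haσ) ha1
  exact ⟨B, hBK, by rw [← hL]; exact hB⟩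

end Sigma

end Literature.NumberTheory.EllipticCurves.KramerTunnell1982

end
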